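import Summits.PneNP.PneNP.Theorems.ConvexRankGatesCliqueExtLowerBoundHorns

/-!
# The three r7 leaves bracketed by one-sided blindness (CONV)
(crux `CliqueExtLowerBound`, stmt-PneNP-10682; line `width-threshold-certificate-sparsity`, lead c10)

By `Horns.cnfPair_of_blind` and `Horns.horns_of_cnfPair` (…CliqueExtLowerBoundHorns), for each gate
class the r7 leaf text (`stub_permCnf` / `stub_grankCnf` / `stub_convWideCnf` of skeleton r7, the
CNF-side form of CnfSide) sits between two CLAUSE-FREE statements about the single monotone Boolean
function `x ↦ φ (fun j => [C j accepts x])` on the referee pair (bare `⌈m^{1/4}⌉₊`-cliques `P`;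
complements `N` of the `(#E/⌊m^{1/8}⌋₊)`-edge graphs):

  blind at `(ε | ε)`  ⇒  r7 leaf  ⇒  blind at `(ε | ε + (r-1)/⌊m^{1/8}⌋₊)`,   `ε = 1/(8 m^{c+1})`,

where "blind at `(a | b)`" means: accepts `≤ a·#P` positives OR rejects `≤ b·#N` negatives. The pair
`(dnf, cnf)`, the clause family and the "accepted wide patterns" of earlier counterexample
descriptions are idle up to that slack; a counterexample to a leaf is one wide gate with local CNF
inputs that WEAKLY SEPARATES the pair. This file: the CONV leaf (PERM and GRANK in …HornsLeaves).
Lead prover seat `prover-line-stmt-PneNP-10682-c10`, 2026-08-17.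
-/

set_option linter.dupNamespace false

open Literature.Computability.Complexity Filter Finset
open Summit.PneNP.PneNP.Theorems.CliqueExtLowerBound.WidthThreshold

noncomputable section

namespace Summit.PneNP.PneNP.Theorems.CliqueExtLowerBound.WidthThreshold.HornsLeaves

open Classical in
/-- **CONV, lower bracket (REGISTERED `convWideCnfText_of_hornSharp`)**: if every wide CONV gate reading `s`-local
monotone CNFs of the edges is ONE-SIDEDLY BLIND at threshold `ε = 1/(8m^{c+1})` on the referee pair
(accepts `≤ ε·#P` bare cliques or rejects `≤ ε·#N` dense negatives), then the r7 leaf text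
`stub_convWideCnf` holds (the constant pairs; `Horns.cnfPair_of_blind`). [folklore] -/
theorem convWideCnfText_of_hornSharp :
    (∀ c : ℕ, ∃ r₀ s₀ : ℕ, 2 ≤ r₀ ∧ 2 ≤ s₀ ∧ ∀ r s : ℕ, r₀ ≤ r → s₀ ≤ s →
    ∀ᶠ m : ℕ in atTop, ∀ φ : GateFn,
      (∃ p q : ℕ, p + q ≤ m ^ c ∧ ⌊(m : ℝ) ^ (1 / 16 : ℝ)⌋₊ < p ∧ c + 1 < q ∧
        ∃ (A : Fin p → Matrix (Fin q) (Fin q) ℝ) (b : Fin p → ℝ)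
        (B : Fin p → Fin φ.1 → ℝ), (∀ i j, 0 ≤ B i j) ∧ ∀ v : Fin φ.1 → Bool, φ.2 v = true ↔
          ∃ Y : Matrix (Fin q) (Fin q) ℝ, Y.PosSemidef ∧
            ∀ i, (A i * Y).trace ≤ b i + ∑ j, B i j * (if v j then (1 : ℝ) else 0)) →
      ∀ C : Fin φ.1 → Finset (Finset ((⊤ : SimpleGraph (Fin m)).edgeSet)),
        #(univ.image C) ≤ m ^ (c + 3) → (∀ j, ∀ S ∈ C j, #S ≤ s - 1) →
        (#((posGraphs m ⌈(m : ℝ) ^ (1 / 4 : ℝ)⌉₊).filter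
            (fun x => φ.2 (fun j => decide (EvalCNF (C j) x)) = true)) : ℝ) ≤
          (1 / (8 * (m : ℝ) ^ (c + 1))) * #(posGraphs m ⌈(m : ℝ) ^ (1 / 4 : ℝ)⌉₊) ∨
        (#((((powersetCard (Fintype.card ((⊤ : SimpleGraph (Fin m)).edgeSet) / ⌊(m : ℝ) ^ (1 / 8 : ℝ)⌋₊)
          (univ : Finset ((⊤ : SimpleGraph (Fin m)).edgeSet))).image (fun M => fun e => decide (e ∉ M)))).filter
            (fun x => φ.2 (fun j => decide (EvalCNF (C j) x)) = false)) : ℝ) ≤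
          (1 / (8 * (m : ℝ) ^ (c + 1))) *
            #(((powersetCard (Fintype.card ((⊤ : SimpleGraph (Fin m)).edgeSet) / ⌊(m : ℝ) ^ (1 / 8 : ℝ)⌋₊)
          (univ : Finset ((⊤ : SimpleGraph (Fin m)).edgeSet))).image (fun M => fun e => decide (e ∉ M))))) →
    ∀ c : ℕ, ∃ r₀ s₀ : ℕ, 2 ≤ r₀ ∧ 2 ≤ s₀ ∧ ∀ r s : ℕ, r₀ ≤ r → s₀ ≤ s →
    ∀ᶠ m : ℕ in atTop, ∀ φ : GateFn,
      (∃ p q : ℕ, p + q ≤ m ^ c ∧ ⌊(m : ℝ) ^ (1 / 16 : ℝ)⌋₊ < p ∧ c + 1 < q ∧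
        ∃ (A : Fin p → Matrix (Fin q) (Fin q) ℝ) (b : Fin p → ℝ)
        (B : Fin p → Fin φ.1 → ℝ), (∀ i j, 0 ≤ B i j) ∧ ∀ v : Fin φ.1 → Bool, φ.2 v = true ↔
          ∃ Y : Matrix (Fin q) (Fin q) ℝ, Y.PosSemidef ∧
            ∀ i, (A i * Y).trace ≤ b i + ∑ j, B i j * (if v j then (1 : ℝ) else 0)) →
      ∀ C : Fin φ.1 → Finset (Finset ((⊤ : SimpleGraph (Fin m)).edgeSet)),
        #(univ.image C) ≤ m ^ (c + 3) → (∀ j, ∀ S ∈ C j, #S ≤ s - 1) →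
        ∃ dnf cnf : Finset (Finset ((⊤ : SimpleGraph (Fin m)).edgeSet)),
          (∀ R ∈ dnf, #R ≤ r - 1) ∧ (∀ S ∈ cnf, #S ≤ s - 1) ∧
          (∀ x, EvalDNF dnf x → EvalCNF cnf x) ∧
          (#((posGraphs m ⌈(m : ℝ) ^ (1 / 4 : ℝ)⌉₊).filter
              (fun x => φ.2 (fun j => decide (EvalCNF (C j) x)) = true ∧ ¬ EvalDNF dnf x)) : ℝ)
            ≤ (1 / (8 * (m : ℝ) ^ (c + 1))) * #(posGraphs m ⌈(m : ℝ) ^ (1 / 4 : ℝ)⌉₊) ∧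
          (#((((powersetCard (Fintype.card ((⊤ : SimpleGraph (Fin m)).edgeSet) / ⌊(m : ℝ) ^ (1 / 8 : ℝ)⌋₊)
          (univ : Finset ((⊤ : SimpleGraph (Fin m)).edgeSet))).image (fun M => fun e => decide (e ∉ M)))).filter
              (fun x => EvalCNF cnf x ∧ φ.2 (fun j => decide (EvalCNF (C j) x)) = false)) : ℝ)
            ≤ (1 / (8 * (m : ℝ) ^ (c + 1))) *
              #(((powersetCard (Fintype.card ((⊤ : SimpleGraph (Fin m)).edgeSet) / ⌊(m : ℝ) ^ (1 / 8 : ℝ)⌋₊)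
          (univ : Finset ((⊤ : SimpleGraph (Fin m)).edgeSet))).image (fun M => fun e => decide (e ∉ M)))) := by
  intro h c
  obtain ⟨r₀, s₀, hr₀, hs₀, h⟩ := h c
  refine ⟨r₀, s₀, hr₀, hs₀, fun r s hr hs => ?_⟩
  filter_upwards [h r s hr hs] with m hm φ hφ C hA hC
  exact Horns.cnfPair_of_blind m (fun x => φ.2 (fun j => decide (EvalCNF (C j) x))) _ _ (by positivity) r s
    (hm φ hφ C hA hC)

open Classical in
/-- **CONV, upper bracket (REGISTERED `hornSlack_of_convWideCnfText`)**: the r7 leaf text `stub_convWideCnf` implies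
that every wide CONV gate reading `s`-local monotone CNFs of the edges is ONE-SIDEDLY BLIND on the
referee pair, with slack `(r-1)/⌊m^{1/8}⌋₊` on the negative side: it accepts `≤ #P/(8m^{c+1})` bare
cliques or rejects `≤ (1/(8m^{c+1}) + (r-1)/⌊m^{1/8}⌋₊)·#N` dense negatives
(`Horns.horns_of_cnfPair`). So a counterexample to the leaf is exactly one such gate that WEAKLY
SEPARATES the pair. [folklore] -/
theorem hornSlack_of_convWideCnfText :
    (∀ c : ℕ, ∃ r₀ s₀ : ℕ, 2 ≤ r₀ ∧ 2 ≤ s₀ ∧ ∀ r s : ℕ, r₀ ≤ r → s₀ ≤ s →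
    ∀ᶠ m : ℕ in atTop, ∀ φ : GateFn,
      (∃ p q : ℕ, p + q ≤ m ^ c ∧ ⌊(m : ℝ) ^ (1 / 16 : ℝ)⌋₊ < p ∧ c + 1 < q ∧
        ∃ (A : Fin p → Matrix (Fin q) (Fin q) ℝ) (b : Fin p → ℝ)
        (B : Fin p → Fin φ.1 → ℝ), (∀ i j, 0 ≤ B i j) ∧ ∀ v : Fin φ.1 → Bool, φ.2 v = true ↔
          ∃ Y : Matrix (Fin q) (Fin q) ℝ, Y.PosSemidef ∧
            ∀ i, (A i * Y).trace ≤ b i + ∑ j, B i j * (if v j then (1 : ℝ) else 0)) →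
      ∀ C : Fin φ.1 → Finset (Finset ((⊤ : SimpleGraph (Fin m)).edgeSet)),
        #(univ.image C) ≤ m ^ (c + 3) → (∀ j, ∀ S ∈ C j, #S ≤ s - 1) →
        ∃ dnf cnf : Finset (Finset ((⊤ : SimpleGraph (Fin m)).edgeSet)),
          (∀ R ∈ dnf, #R ≤ r - 1) ∧ (∀ S ∈ cnf, #S ≤ s - 1) ∧
          (∀ x, EvalDNF dnf x → EvalCNF cnf x) ∧
          (#((posGraphs m ⌈(m : ℝ) ^ (1 / 4 : ℝ)⌉₊).filter
              (fun x => φ.2 (fun j => decide (EvalCNF (C j) x)) = true ∧ ¬ EvalDNF dnf x)) : ℝ)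
            ≤ (1 / (8 * (m : ℝ) ^ (c + 1))) * #(posGraphs m ⌈(m : ℝ) ^ (1 / 4 : ℝ)⌉₊) ∧
          (#((((powersetCard (Fintype.card ((⊤ : SimpleGraph (Fin m)).edgeSet) / ⌊(m : ℝ) ^ (1 / 8 : ℝ)⌋₊)
          (univ : Finset ((⊤ : SimpleGraph (Fin m)).edgeSet))).image (fun M => fun e => decide (e ∉ M)))).filter
              (fun x => EvalCNF cnf x ∧ φ.2 (fun j => decide (EvalCNF (C j) x)) = false)) : ℝ)
            ≤ (1 / (8 * (m : ℝ) ^ (c + 1))) *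
              #(((powersetCard (Fintype.card ((⊤ : SimpleGraph (Fin m)).edgeSet) / ⌊(m : ℝ) ^ (1 / 8 : ℝ)⌋₊)
          (univ : Finset ((⊤ : SimpleGraph (Fin m)).edgeSet))).image (fun M => fun e => decide (e ∉ M))))) →
    ∀ c : ℕ, ∃ r₀ s₀ : ℕ, 2 ≤ r₀ ∧ 2 ≤ s₀ ∧ ∀ r s : ℕ, r₀ ≤ r → s₀ ≤ s →
    ∀ᶠ m : ℕ in atTop, ∀ φ : GateFn,
      (∃ p q : ℕ, p + q ≤ m ^ c ∧ ⌊(m : ℝ) ^ (1 / 16 : ℝ)⌋₊ < p ∧ c + 1 < q ∧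
        ∃ (A : Fin p → Matrix (Fin q) (Fin q) ℝ) (b : Fin p → ℝ)
        (B : Fin p → Fin φ.1 → ℝ), (∀ i j, 0 ≤ B i j) ∧ ∀ v : Fin φ.1 → Bool, φ.2 v = true ↔
          ∃ Y : Matrix (Fin q) (Fin q) ℝ, Y.PosSemidef ∧
            ∀ i, (A i * Y).trace ≤ b i + ∑ j, B i j * (if v j then (1 : ℝ) else 0)) →
      ∀ C : Fin φ.1 → Finset (Finset ((⊤ : SimpleGraph (Fin m)).edgeSet)),
        #(univ.image C) ≤ m ^ (c + 3) → (∀ j, ∀ S ∈ C j, #S ≤ s - 1) →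
        (#((posGraphs m ⌈(m : ℝ) ^ (1 / 4 : ℝ)⌉₊).filter
            (fun x => φ.2 (fun j => decide (EvalCNF (C j) x)) = true)) : ℝ) ≤
          (1 / (8 * (m : ℝ) ^ (c + 1))) * #(posGraphs m ⌈(m : ℝ) ^ (1 / 4 : ℝ)⌉₊) ∨
        (#((((powersetCard (Fintype.card ((⊤ : SimpleGraph (Fin m)).edgeSet) / ⌊(m : ℝ) ^ (1 / 8 : ℝ)⌋₊)
          (univ : Finset ((⊤ : SimpleGraph (Fin m)).edgeSet))).image (fun M => fun e => decide (e ∉ M)))).filter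
            (fun x => φ.2 (fun j => decide (EvalCNF (C j) x)) = false)) : ℝ) ≤
          (1 / (8 * (m : ℝ) ^ (c + 1)) + ((r - 1 : ℕ) : ℝ) / ⌊(m : ℝ) ^ (1 / 8 : ℝ)⌋₊) *
            #(((powersetCard (Fintype.card ((⊤ : SimpleGraph (Fin m)).edgeSet) / ⌊(m : ℝ) ^ (1 / 8 : ℝ)⌋₊)
          (univ : Finset ((⊤ : SimpleGraph (Fin m)).edgeSet))).image (fun M => fun e => decide (e ∉ M)))) := by
  intro h c
  obtain ⟨r₀, s₀, hr₀, hs₀, h⟩ := h c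
  refine ⟨r₀, s₀, hr₀, hs₀, fun r s hr hs => ?_⟩
  filter_upwards [h r s hr hs, eventually_ge_atTop 1] with m hm h1 φ hφ C hA hC
  exact Horns.horns_of_cnfPair m h1 (fun x => φ.2 (fun j => decide (EvalCNF (C j) x))) _ _ r s
    (hm φ hφ C hA hC)

end Summit.PneNP.PneNP.Theorems.CliqueExtLowerBound.WidthThreshold.HornsLeaves

end
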